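import Literature.AlgebraicGeometry.Frobenioids.EquivalenceFrobeniusType
import HarnessLib

/-!
# Frobenioids I, §3: Theorem 3.4 (iii) — the preservation list (linear morphisms, base-isomorphisms,
# pull-back morphisms, isometries, co-angular and LB-invertible morphisms) over bases of FSM-type

Mochizuki, *The geometry of Frobenioids I: the general theory*, Kyushu J. Math. **62** (2008),
Thm. 3.4 (iii), proof, kurims p. 64: "… the condition of the claim implies that `Ψ^istr` preserves
morphisms of Frobenius type, hence also linear morphisms [by Proposition 1.7, (iii)] … Moreover, by
assertions (i), (ii), `Ψ` preserves isometric pre-steps and pre-steps, hence base-isomorphisms [cf.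
Proposition 1.7, (ii)], pull-back morphisms [cf. Proposition 1.7, (ii)], isometries …, co-angular
morphisms …, and LB-invertible morphisms" [cite: MochizukiFrdI2008, Thm. 3.4 (iii) p.64].

PROOF-ONLY (seat abc-iut-L1-t13; the cell's repair programme over bases of FSM-type). Standing
hypotheses: `C₁`, `C₂` Frobenioids of isotropic type over bases of FSM-type, `Φ₁`, `Φ₂` non-dilating,
each `C_i` with a non-group-like object, `Ψ : C₁ ≌ C₂`. Then `Ψ` preserves linear morphisms
(Prop. 1.7 (iii): minimal-adjoint to Frobenius type, which `Ψ⁻¹` preserves by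
`FrdI.isFrobeniusType_map`), base-isomorphisms (Prop. 1.7 (ii): (Frobenius type) then (pre-step)),
pull-back morphisms (Prop. 1.7 (ii): minimal-adjoint to base-isomorphisms), isometries (Def. 1.3
(iv)(a) factorisation; an isometric pre-step out of an isotropic object is invertible), co-angular and
LB-invertible morphisms. No statement of the paper is restated or strengthened.
-/

set_option backward.isDefEq.respectTransparency false

namespace Literature.AlgebraicGeometry.Frobenioids

open CategoryTheory Opposite

universe w v v' u u'

namespace FrdI

section Two

variable {D₁ : Type u} [Category.{v} D₁] {Φ₁ : D₁ᵒᵖ ⥤ CommMonCat.{w}} {C₁ : Type u'}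
  [Category.{v'} C₁] {D₂ : Type u} [Category.{v} D₂] {Φ₂ : D₂ᵒᵖ ⥤ CommMonCat.{w}} {C₂ : Type u'}
  [Category.{v'} C₂] {F₁ : C₁ ⥤ ElemFrobenioid Φ₁} {F₂ : C₂ ⥤ ElemFrobenioid Φ₂}

/-- **Thm. 3.4 (iii): `Ψ` preserves linear morphisms** (Prop. 1.7 (iii) + Frobenius type preserved by
`Ψ⁻¹`). [cite: MochizukiFrdI2008, Thm. 3.4 (iii) p.64] -/
theorem isLinear_map (hF₁ : PreFrobenioid.IsFrobenioid F₁) (hF₂ : PreFrobenioid.IsFrobenioid F₂)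
    (hi₁ : ∀ A : C₁, PreFrobenioid.IsIsotropic F₁ A) (hi₂ : ∀ A : C₂, PreFrobenioid.IsIsotropic F₂ A)
    (hD₁ : IsOfFSMType D₁) (hD₂ : IsOfFSMType D₂) (hnd₁ : IsNonDilatingOn Φ₁) (Ψ : C₁ ≌ C₂)
    {N₂ : C₂} (hN₂ : ¬ PreFrobenioid.IsGroupLikeObj F₂ N₂) {A B : C₁} {φ : A ⟶ B}
    (hφ : PreFrobenioid.IsLinear F₁ φ) : PreFrobenioid.IsLinear F₂ (Ψ.functor.map φ) := by
  rw [PreFrobenioid.isLinear_iff_isMinimalAdjoint F₂ hF₂]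
  refine ((PreFrobenioid.isLinear_iff_isMinimalAdjoint F₁ hF₁ φ).1 hφ).map_equivalence Ψ
    (S₂ := fun _ _ f => PreFrobenioid.IsFrobeniusType F₂ f) (fun X Y β hβ => ?_) (fun X X' Y i β hi hβ => ?_)
  · exact isFrobeniusType_map hF₂ hF₁ hi₂ hi₁ hD₂ hD₁ hnd₁ Ψ.symm hN₂ _ hβ rfl
  · haveI := hi
    exact PreFrobenioid.IsFrobeniusType.comp F₁ hF₁ (PreFrobenioid.isFrobeniusType_of_isIso F₁ hF₁.isPreFrobenioid i) hβ

/-- **Thm. 3.4 (iii): `Ψ` preserves base-isomorphisms** (Prop. 1.7 (ii): a base-isomorphism is a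
morphism of Frobenius type followed by a pre-step). [cite: MochizukiFrdI2008, Thm. 3.4 (iii) p.64] -/
theorem isBaseIso_map (hF₁ : PreFrobenioid.IsFrobenioid F₁) (hF₂ : PreFrobenioid.IsFrobenioid F₂)
    (hi₁ : ∀ A : C₁, PreFrobenioid.IsIsotropic F₁ A) (hi₂ : ∀ A : C₂, PreFrobenioid.IsIsotropic F₂ A)
    (hD₁ : IsOfFSMType D₁) (hD₂ : IsOfFSMType D₂) (hnd₂ : IsNonDilatingOn Φ₂) (Ψ : C₁ ≌ C₂)
    {N₁ : C₁} (hN₁ : ¬ PreFrobenioid.IsGroupLikeObj F₁ N₁) {A B : C₁} {φ : A ⟶ B}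
    (hφ : PreFrobenioid.IsBaseIso F₁ φ) : PreFrobenioid.IsBaseIso F₂ (Ψ.functor.map φ) := by
  obtain ⟨X, β, α, hfac, hβ, hα⟩ :=
    (PreFrobenioid.isBaseIso_iff_exists_frobeniusType_preStep F₁ hF₁ φ).1 hφ
  rw [← hfac, Functor.map_comp]
  exact PreFrobenioid.IsBaseIso.comp F₂
    (isFrobeniusType_map hF₁ hF₂ hi₁ hi₂ hD₁ hD₂ hnd₂ Ψ hN₁ _ hβ rfl).2
    (isPreStep_map_of_isOfFSMType hF₁ hF₂ hi₁ hi₂ hD₂ Ψ hα).2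

/-- **Thm. 3.4 (iii): `Ψ` preserves pull-back morphisms** (Prop. 1.7 (ii): minimal-adjoint to the
base-isomorphisms, which `Ψ⁻¹` preserves). [cite: MochizukiFrdI2008, Thm. 3.4 (iii) p.64] -/
theorem isPullbackMorphism_map (hF₁ : PreFrobenioid.IsFrobenioid F₁)
    (hF₂ : PreFrobenioid.IsFrobenioid F₂) (hi₁ : ∀ A : C₁, PreFrobenioid.IsIsotropic F₁ A)
    (hi₂ : ∀ A : C₂, PreFrobenioid.IsIsotropic F₂ A) (hD₁ : IsOfFSMType D₁) (hD₂ : IsOfFSMType D₂)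
    (hnd₁ : IsNonDilatingOn Φ₁) (Ψ : C₁ ≌ C₂) {N₂ : C₂} (hN₂ : ¬ PreFrobenioid.IsGroupLikeObj F₂ N₂)
    {A B : C₁} {φ : A ⟶ B} (hφ : PreFrobenioid.IsPullbackMorphism F₁ φ) :
    PreFrobenioid.IsPullbackMorphism F₂ (Ψ.functor.map φ) := by
  rw [PreFrobenioid.isPullbackMorphism_iff_isMinimalAdjoint F₂ hF₂]
  refine ((PreFrobenioid.isPullbackMorphism_iff_isMinimalAdjoint F₁ hF₁ φ).1 hφ).map_equivalence Ψ
    (S₂ := PreFrobenioid.baseIsomorphisms F₂) (fun X Y β hβ => ?_) (fun X X' Y i β hi hβ => ?_)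
  · exact isBaseIso_map hF₂ hF₁ hi₂ hi₁ hD₂ hD₁ hnd₁ Ψ.symm hN₂ hβ
  · haveI := hi
    exact PreFrobenioid.IsBaseIso.comp F₁ (PreFrobenioid.isBaseIso_of_isIso F₁ i) hβ

/-- **Thm. 3.4 (iii): `Ψ` preserves isometries** (factor `φ = α ∘ β ∘ γ`, Def. 1.3 (iv)(a): the
pre-step `β` is isometric, hence invertible in isotropic type; `Ψγ` is of Frobenius type and `Ψα` a
pull-back morphism). [cite: MochizukiFrdI2008, Thm. 3.4 (iii) p.64] -/
theorem isIsometry_map (hF₁ : PreFrobenioid.IsFrobenioid F₁) (hF₂ : PreFrobenioid.IsFrobenioid F₂)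
    (hi₁ : ∀ A : C₁, PreFrobenioid.IsIsotropic F₁ A) (hi₂ : ∀ A : C₂, PreFrobenioid.IsIsotropic F₂ A)
    (hD₁ : IsOfFSMType D₁) (hD₂ : IsOfFSMType D₂) (hnd₁ : IsNonDilatingOn Φ₁)
    (hnd₂ : IsNonDilatingOn Φ₂) (Ψ : C₁ ≌ C₂) {N₁ : C₁} (hN₁ : ¬ PreFrobenioid.IsGroupLikeObj F₁ N₁)
    {N₂ : C₂} (hN₂ : ¬ PreFrobenioid.IsGroupLikeObj F₂ N₂) {A B : C₁} {φ : A ⟶ B}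
    (hφ : PreFrobenioid.IsIsometry F₁ φ) : PreFrobenioid.IsIsometry F₂ (Ψ.functor.map φ) := by
  have hP₁ := hF₁.isPreFrobenioid
  have hP₂ := hF₂.isPreFrobenioid
  obtain ⟨X, Y, γ, β, α, hfac, hγ, hβ, hα⟩ := hF₁.iv_a_exists φ
  -- the middle pre-step is an isometry, hence an isomorphism
  have hβi : PreFrobenioid.IsIsometry F₁ β := by
    have h : PreFrobenioid.IsIsometry F₁ (γ ≫ β ≫ α) := by rw [hfac]; exact hφ
    exact (PreFrobenioid.isIsometry_factors F₁ hP₁ (PreFrobenioid.isIsometry_factors F₁ hP₁ h).1).2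
  haveI : IsIso β := hi₁ X β hβi hβ
  rw [← hfac, Functor.map_comp, Functor.map_comp]
  refine PreFrobenioid.IsIsometry.comp F₂
    (isFrobeniusType_map hF₁ hF₂ hi₁ hi₂ hD₁ hD₂ hnd₂ Ψ hN₁ _ hγ rfl).1.2
    (PreFrobenioid.IsIsometry.comp F₂ (PreFrobenioid.isIsometry_of_isIso F₂ hP₂ _) ?_)
  exact (hF₂.iv_b _ (isPullbackMorphism_map hF₁ hF₂ hi₁ hi₂ hD₁ hD₂ hnd₁ Ψ hN₂ hα)).1.2

/-- **Thm. 3.4 (iii): `Ψ` preserves co-angular and LB-invertible morphisms** (every morphism of a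
Frobenioid of isotropic type is co-angular). [cite: MochizukiFrdI2008, Thm. 3.4 (iii) p.64] -/
theorem isLBInvertible_map (hF₁ : PreFrobenioid.IsFrobenioid F₁)
    (hF₂ : PreFrobenioid.IsFrobenioid F₂) (hi₁ : ∀ A : C₁, PreFrobenioid.IsIsotropic F₁ A)
    (hi₂ : ∀ A : C₂, PreFrobenioid.IsIsotropic F₂ A) (hD₁ : IsOfFSMType D₁) (hD₂ : IsOfFSMType D₂)
    (hnd₁ : IsNonDilatingOn Φ₁) (hnd₂ : IsNonDilatingOn Φ₂) (Ψ : C₁ ≌ C₂) {N₁ : C₁}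
    (hN₁ : ¬ PreFrobenioid.IsGroupLikeObj F₁ N₁) {N₂ : C₂} (hN₂ : ¬ PreFrobenioid.IsGroupLikeObj F₂ N₂)
    {A B : C₁} {φ : A ⟶ B} (hφ : PreFrobenioid.IsLBInvertible F₁ φ) :
    PreFrobenioid.IsLBInvertible F₂ (Ψ.functor.map φ) :=
  ⟨PreFrobenioid.isCoAngular_of_isIsotropic_codomains F₂ _ (fun Z _ => hi₂ Z),
    isIsometry_map hF₁ hF₂ hi₁ hi₂ hD₁ hD₂ hnd₁ hnd₂ Ψ hN₁ hN₂ hφ.2⟩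

end Two

end FrdI

end Literature.AlgebraicGeometry.Frobenioids
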